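import Summits.BirchSwinnertonDyer.BirchSwinnertonDyer.Theorems.ShaPrimaryTransferFiniteShaComponentTransferSelmerCubicCoverCl
import Literature.NumberTheory.EllipticCurves.KubertTateSevenRational
import HarnessLib

/-!
# BirchSwinnertonDyer — the SEL2CUBIC door for the CLASS-GROUP-GENERAL kernel `2`-descent rows
# (`TwoDescCl.checkLe r`): certificate ⟹ `t₂(E) = 0`, `Ш(E/ℚ)[2^∞] = 0`, `rank E(ℚ) = r`

HONEST FRAMING: route `ShaPrimaryTransfer`, seat `bsd-line-spt-p1` (g29–g30), `--supports` item T =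
`FiniteShaComponentTransfer` (stmt-22356), UNCHANGED (conjecture-grade at corank ≥ 2). BSD in rank ≥ 2 is NOT
proved by any of this. THEOREMS ONLY.

The cell-`b2b-bsdr2` class-group-general kernel `2`-descent (`Rank2Observatory2DescClRowCertLe`: a checked field
record `fc : ClFieldCert`, a curve record `cc : ClCurveCert` passing `checkLe r fc cc`, complex cubic `2`-division
field of ANY class number, modulus `M = F′(θ)·q`) bounds the image of `E(ℚ)/2E(ℚ)` and concludes `rank E(ℚ) ≤ r`
(`rank_le_of_checkLe_cl`). Its use of the rational point is confined to two facts — `ord_v(x − θ)` even at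
`v ∌ F′(θ)` and the norm/sign of `x − θ` — both of which the tree now has for ALL `2`-Selmer classes
(`two_dvd_log_valuation_of_mem_selmerGroup`, `admStd_sound_sel`). This file runs the SAME certificate on
`Sel⁽²⁾(E/ℚ)`:

* (from `…SelmerCubicCoverCl`: `natCard_selmerGroup_le_of_coverSet_cl`, `valRow_sound_sel`,
  `sha_door_of_natCard_selmerGroup_two_lt`);
* **`sha_door_of_checkLe_cl`** — `fc.check ∧ checkLe r fc cc ∧ r ≤ rank ⟹ t₂(E) = 0 ∧ Ш(E/ℚ)[2^∞] = 0 ∧ rank = r`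
  for the model `(0, A, 0, B, C)` (the proof of `rank_le_of_checkLe_cl` verbatim up to the sieve-soundness step —
  adapted from `Rank2Observatory2DescClRowCertLe.lean`);
* **`sha_door_of_certsLe`**, **`shaCorank_two_eq_zero_of_certsLe_complSq`** — the `K`-free wrappers over
  `CubicField a b c` in the exact shape of the census rows' `rank_eq_of_certsLe` / `rank_eq_of_certsLe_complSq`:
  every sharded `checkLe` row becomes an unconditional `t₂ = 0` door by swapping the theorem name.
[cite: Cassels1991LecturesEllipticCurves, §15] [cite: SilvermanAEC2009, Thm. X.4.2, Rem. X.4.1]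
[cite: CremonaAlgorithms1997, §3.6]
-/

-- single-conjunct summit: `Summit.BirchSwinnertonDyer.BirchSwinnertonDyer.…` repeats the name by design
set_option linter.dupNamespace false

noncomputable section

open scoped Classical NumberField nonZeroDivisors

open Literature.NumberTheory.NumberFields Literature.NumberTheory.EllipticCurves
  Literature.NumberTheory.GaloisRepresentations Polynomial Module NumberField IsDedekindDomain Ideal
open WeierstrassCurve WeierstrassCurve.Affine

namespace Summit.BirchSwinnertonDyer.BirchSwinnertonDyer.Theorems.ShaPrimaryTransferSelmerCubicCover

open Summit.BirchSwinnertonDyer.BirchSwinnertonDyer.Rank2Observatory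
open Summit.BirchSwinnertonDyer.BirchSwinnertonDyer.Rank2Observatory.TwoDescCubic
open Summit.BirchSwinnertonDyer.BirchSwinnertonDyer.Rank2Observatory.TwoDescCl
open Summit.BirchSwinnertonDyer.BirchSwinnertonDyer.Rank2Observatory.TwoDescCl.ClFieldCert

/-! ## The row door -/

section Row

variable {K : Type} [Field K] [NumberField K] {θ : K}

/-- **The SEL2CUBIC door for a `checkLe r` row: `t₂(E) = 0`, `Ш(E/ℚ)[2^∞] = 0`, `rank E(ℚ) = r`.** For a
checked field record `fc` (complex cubic `K = ℚ(θ)`, any class number), a curve record `cc` passing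
`checkLe r fc cc` (model `E = (0, A, 0, B, C)`) and a lower bound `r ≤ rank E(ℚ)`: the certificate's sieve accepts
the Cassels class of every `2`-Selmer class (`admStd_sound_sel` for the norm and sign clauses, `valRow_sound_sel`
for the two valuation rows), so `#Sel⁽²⁾(E/ℚ) ≤ #admissible < 2^{r+1}` (`natCard_selmerGroup_le_of_coverSet_cl`),
and the descent count closes (`sha_door_of_natCard_selmerGroup_two_lt`). The decoding of the records is the proof
of `rank_le_of_checkLe_cl` verbatim (adapted from `Rank2Observatory2DescClRowCertLe.lean`).
UNCONDITIONAL; BSD is not claimed. [cite: Cassels1991LecturesEllipticCurves, §15]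
[cite: SilvermanAEC2009, Thm. X.4.2, Rem. X.4.1] [cite: CremonaAlgorithms1997, §3.6] -/
theorem sha_door_of_checkLe_cl (r : ℕ) (fc : ClFieldCert) (hθ : aeval θ (MonicCubic.poly fc.a fc.b fc.c) = 0)
    (h3 : finrank ℚ K = 3) (hF : fc.check = true) (hpr : fc.primeList.Forall Nat.Prime) (cc : ClCurveCert)
    (hc : checkLe r fc cc = true) (hlow : r ≤ ((⟨0, cc.A, 0, cc.B, cc.C⟩ : WeierstrassCurve ℚ)).mordellWeilRank) :
    ((⟨0, cc.A, 0, cc.B, cc.C⟩ : WeierstrassCurve ℚ)).shaCorank 2 = 0 ∧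
      AddCommGroup.primaryComponent ((⟨0, cc.A, 0, cc.B, cc.C⟩ : WeierstrassCurve ℚ)).sha 2 = ⊥ ∧
        ((⟨0, cc.A, 0, cc.B, cc.C⟩ : WeierstrassCurve ℚ)).mordellWeilRank = r := by
  classical
  have hirr := fc.irreducible_of_check hF
  have hq := fc.q_prime hpr
  simp only [checkLe, Bool.and_eq_true, decide_eq_true_eq, List.all_eq_true, List.any_eq_true,
    Bool.or_eq_true, beq_iff_eq] at hc
  obtain ⟨⟨⟨⟨⟨⟨⟨⟨⟨⟨⟨⟨⟨⟨hΔ, hirrF⟩, hcub⟩, hder⟩, hdisc⟩, hND0⟩, hdn⟩, hdnC⟩, hcodes⟩, hdW1⟩, hdW2⟩, hQ⟩,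
    hfamAll⟩, hcert⟩, hcount⟩ := hc
  haveI hE := isElliptic_of_deltaShort_ne hΔ
  have hirrF' := irreducible_of_noRootMod hirrF
  -- `θ_E`, `D`, `M = D·q`
  have haev := aeval_lin_eq_zero_of_coords hθ cc.t hcub
  have hderiv : (3 : 𝓞 K) * (lin hθ cc.t.1 cc.t.2.1 cc.t.2.2) ^ 2 +
      2 * ((cc.A : ℤ) : 𝓞 K) * (lin hθ cc.t.1 cc.t.2.1 cc.t.2.2) + ((cc.B : ℤ) : 𝓞 K) =
        lin hθ cc.D.1 cc.D.2.1 cc.D.2.2 := by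
    simpa using deriv_eq_of_coords hθ cc.t cc.D [] hder
  have hD0 : (lin hθ cc.D.1 cc.D.2.1 cc.D.2.2 : 𝓞 K) ≠ 0 := lin_ne_zero_of_coords hirr hθ h3 _ hND0
  have hq0 : ((fc.q : ℕ) : 𝓞 K) ≠ 0 := by exact_mod_cast hq.ne_zero
  have hM0 : (lin hθ cc.D.1 cc.D.2.1 cc.D.2.2 : 𝓞 K) * ((fc.q : ℕ) : 𝓞 K) ≠ 0 := mul_ne_zero hD0 hq0
  have hgen := closure_tsupp_eq_top_of_dvd
    (dvd_mul_left ((fc.q : ℕ) : 𝓞 K) (lin hθ cc.D.1 cc.D.2.1 cc.D.2.2)) (fc.closure_q_eq_top_of_check hθ h3 hF hpr)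
  have hDM : ∀ v : HeightOneSpectrum (𝓞 K), (3 : 𝓞 K) * (lin hθ cc.t.1 cc.t.2.1 cc.t.2.2) ^ 2 +
      2 * ((cc.A : ℤ) : 𝓞 K) * (lin hθ cc.t.1 cc.t.2.1 cc.t.2.2) + ((cc.B : ℤ) : 𝓞 K) ∈ v.asIdeal →
      (lin hθ cc.D.1 cc.D.2.1 cc.D.2.2 : 𝓞 K) * ((fc.q : ℕ) : 𝓞 K) ∈ v.asIdeal := by
    intro v hv
    rw [hderiv] at hv
    exact Ideal.mul_mem_right _ _ hv
  have hDW₁ : (lin hθ cc.D.1 cc.D.2.1 cc.D.2.2 : 𝓞 K) ∉ (fc.W₁ hθ h3 hF hpr).asIdeal :=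
    lin_not_mem_of_invCert hθ _ (W₁_asIdeal hθ h3 hF hpr) hdW1
  have hDW₂ : (lin hθ cc.D.1 cc.D.2.1 cc.D.2.2 : 𝓞 K) ∉ (fc.W₂ hθ h3 hF hpr).asIdeal :=
    lin_not_mem_of_invCert hθ _ (W₂_asIdeal hθ h3 hF hpr) hdW2
  -- the support `T = {W₁, W₂} ∪ codes`
  set L := cc.codes.length with hL
  let Tf : Fin (L + 2) → HeightOneSpectrum (𝓞 K) := Matrix.vecCons (fc.W₁ hθ h3 hF hpr)
    (Matrix.vecCons (fc.W₂ hθ h3 hF hpr) fun i => codePrime hθ h3 hF hpr (cc.codes.get i))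
  have hT : ∀ w : HeightOneSpectrum (𝓞 K),
      (lin hθ cc.D.1 cc.D.2.1 cc.D.2.2 : 𝓞 K) * ((fc.q : ℕ) : 𝓞 K) ∈ w.asIdeal → ∃ i, Tf i = w := by
    intro w hw
    rcases w.isPrime.mem_or_mem hw with hD | hqw
    · obtain ⟨l, hl, hldvd, hlw⟩ := exists_prime_dvd_norm_mem w hD0 hD
      rw [natAbs_norm_lin_coords hirr hθ h3, hdn] at hldvd
      obtain ⟨a, ha, hla⟩ := (Prime.dvd_prod_iff hl.prime).mp hldvd
      obtain ⟨pe, hpe, rfl⟩ := List.mem_map.mp ha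
      obtain ⟨hany, hrowcodes⟩ := hdnC pe hpe
      have hany' : (fc.primes.any fun e => e.p == pe.1) = true := by simpa [List.any_eq_true] using hany
      obtain ⟨hrow, hrowp⟩ := row_mem hany'
      have hpp : (fc.row pe.1).p.Prime := fc.prime_of_mem hpr hrow
      have hl_eq : l = pe.1 :=
        (Nat.prime_dvd_prime_iff_eq hl (hrowp ▸ hpp)).mp (hl.dvd_of_dvd_pow hla)
      have hlw' : ((fc.row pe.1).p : 𝓞 K) ∈ w.asIdeal := by rw [hrowp, ← hl_eq]; exact hlw
      obtain ⟨C', hC', hw'⟩ :=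
        exists_code_of_natCast_mem hirr hθ h3 hpp (fc.row_check_of_mem hF hrow).1 w hlw'
      rcases hrowcodes C' hC' with hmem | ⟨ci, -, hci, hinv⟩
      · obtain ⟨i, hi⟩ := List.mem_iff_get.mp hmem
        obtain ⟨hc1, hc2⟩ := hcodes _ (List.get_mem _ i)
        have hc1' : (fc.primes.any fun e => e.p == (cc.codes.get i).1) = true := by
          simpa [List.any_eq_true] using hc1
        refine ⟨i.succ.succ, HeightOneSpectrum.ext ?_⟩
        simp only [Tf, Matrix.cons_val_succ]
        rw [codePrime_asIdeal hθ h3 hF hpr hc1' hc2, hi, hw']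
      · exact absurd hD (lin_not_mem_of_invCert hθ w hw' hinv)
    · rcases eq_W₁_or_W₂ hθ h3 hF hpr w hqw with rfl | rfl
      · exact ⟨0, by simp [Tf]⟩
      · exact ⟨1, by simp [Tf]⟩
  -- the family
  set fm := fam fc cc with hfm
  let W : Fin fm.length → 𝓞 K := fun j => lin hθ (fm.get j).2.2.g.1 (fm.get j).2.2.g.2.1 (fm.get j).2.2.g.2.2
  have hfam : ∀ j : Fin fm.length, famCheck fc cc.D (fm.get j) = true := fun j => hfamAll _ (List.get_mem _ j)
  have hW0 : ∀ j, W j ≠ 0 := fun j => lin_ne_zero_of_famCheck hθ h3 hF (hfam j)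
  have hWval : ∀ j (v : HeightOneSpectrum (𝓞 K)),
      (lin hθ cc.D.1 cc.D.2.1 cc.D.2.2 : 𝓞 K) * ((fc.q : ℕ) : 𝓞 K) ∉ v.asIdeal →
        v.valuation K (algebraMap (𝓞 K) K (W j)) = 1 :=
    fun j v hv => valuation_eq_one_of_support _ _ (supp_of_famCheck hθ h3 hF hpr (hfam j)) v hv
  obtain ⟨ρ, hlo, hhi⟩ := fc.exists_rho_of_check hθ h3 hF
  -- independence modulo squares: the parity certificate
  have hind : ∀ S : Finset (Fin fm.length), IsSquare (∏ i ∈ S, algebraMap (𝓞 K) K (W i)) → S = ∅ := by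
    intro S hS
    refine indep_of_parity_certificate (fun i => algebraMap (𝓞 K) K (W i)) (bit fc cc) ?_ hcert S hS
    intro k S' hS'
    have hS'' : IsSquare (∏ i ∈ S', W i) := isSquare_prod_of_isSquare_prod_coe _ hS'
    obtain ⟨k, hk⟩ := k
    rcases k with _ | _ | _ | k
    · have h := even_card_of_isSquare_real ρ (fun i => algebraMap (𝓞 K) K (W i))
        (fun i => rho_ne_zero_of_famCheck hθ ρ hlo hhi hF (hfam i)) hS'
      convert h using 2
      refine Finset.filter_congr (fun i _ => ?_)
      exact sign_iff_of_famCheck hθ ρ hlo hhi hF (hfam i)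
    · exact even_card_of_isSquare_valuation (fc.W₁ hθ h3 hF hpr) W hW0 _
        (fun i => by
          show ((!decide ((2 : ℤ) ∣ famL₁ (fm.get i))) = true ↔ _)
          rw [log_W₁_of_famCheck hθ h3 hF hpr (hfam i)]; simp) hS'
    · exact even_card_of_isSquare_valuation (fc.W₂ hθ h3 hF hpr) W hW0 _
        (fun i => by
          show ((!decide ((2 : ℤ) ∣ famL₂ (fm.get i))) = true ↔ _)
          rw [log_W₂_of_famCheck hθ h3 hF hpr (hfam i)]; simp) hS'
    · have hk' : k < fc.chars.length := by omega
      have hch : fc.chars.getD k ((3 : ℕ), (0 : ℤ), (0 : ℤ)) ∈ fc.chars := by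
        rw [List.getD_eq_getElem?_getD, List.getElem?_eq_getElem hk', Option.getD_some]
        exact List.getElem_mem hk'
      obtain ⟨h2, ψ, hψ⟩ := fc.exists_psi_of_check hθ h3 hF hpr hch
      haveI : Fact (fc.chars.getD k (3, 0, 0)).1.Prime := ⟨fc.char_prime hpr hch⟩
      have h := even_card_filter_eulerBit hθ (ℓ := (fc.chars.getD k (3, 0, 0)).1) (by omega) ψ hψ
        (fun i => (fm.get i).2.2.g) (fun i => not_dvd_evalInt_of_famCheck (hfam i) hch) hS''
      convert h using 2
      exact Finset.filter_congr (fun i _ => Iff.rfl)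
  -- spanning of the `T`-units modulo squares
  have hodd : Odd (finrank ℚ K) := by rw [h3]; decide
  have hn : fm.length = NumberField.Units.rank K + 1 + (L + 2) := by
    rw [fc.units_rank_of_check hθ h3 hF]
    simp only [hfm, fam, List.length_cons, List.length_map, hL]
    omega
  have hspan : ∀ u : K, u ≠ 0 →
      (∀ v : HeightOneSpectrum (𝓞 K),
        (lin hθ cc.D.1 cc.D.2.1 cc.D.2.2 : 𝓞 K) * ((fc.q : ℕ) : 𝓞 K) ∉ v.asIdeal → v.valuation K u = 1) →
      ∃ U : Finset (Fin fm.length), IsSquare (u * ∏ j ∈ U, algebraMap (𝓞 K) K (W j)) :=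
    fun u hu huT => exists_isSquare_tunit_mul_prod hodd _ Tf hT hn (fun j => algebraMap (𝓞 K) K (W j))
      (fun j => RingOfIntegers.coe_ne_zero_iff.mpr (hW0 j)) hWval hind u hu huT
  -- the sieve is sound on `2`-Selmer classes
  haveI hEK : (((⟨0, cc.A, 0, cc.B, cc.C⟩ : WeierstrassCurve ℚ)).baseChange K).IsElliptic := ((⟨0, cc.A, 0, cc.B, cc.C⟩ : WeierstrassCurve ℚ)).isElliptic_baseChange K
  have hΔneg : ((⟨0, cc.A, 0, cc.B, cc.C⟩ : WeierstrassCurve ℚ)).Δ < 0 := by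
    rw [Δ_shortModel_eq_sixteen_mul_disc]
    exact_mod_cast (show 16 * MonicCubic.disc cc.A cc.B cc.C < 0 by linarith [hdisc])
  have hadm : ∀ c ∈ selmerGroup ((⟨0, cc.A, 0, cc.B, cc.C⟩ : WeierstrassCurve ℚ)) 2, ∀ a : Kˣ,
      kummerEquiv K 2 (((⟨0, cc.A, 0, cc.B, cc.C⟩ : WeierstrassCurve ℚ)).oneRootDescentH1 K
        (isTwoTorsionX_of_aeval (A := cc.A) (B := cc.B) (C := cc.C) ((⟨0, cc.A, 0, cc.B, cc.C⟩ : WeierstrassCurve ℚ)) rfl rfl rfl rfl rfl haev) c) =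
        Additive.ofMul (QuotientGroup.mk a) →
      ∀ (T : Finset (Fin 0)) (U : Finset (Fin fm.length)),
        IsSquare ((a : K) *
          (∏ i ∈ T, algebraMap (𝓞 K) K (((fun i : Fin 0 => i.elim0 : Fin 0 → (𝓞 K)ˣ) i : (𝓞 K)ˣ) : 𝓞 K)) *
            ∏ j ∈ U, algebraMap (𝓞 K) K (W j)) → adm fc cc T U = true := by
    intro c hc a ha T U hsq
    have h1 : admStd (fun i : Fin 0 => i.elim0) (famNorm fc cc) (fun i : Fin 0 => i.elim0) (famSign fc cc) T U =
        true :=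
      admStd_sound_sel (A := cc.A) (B := cc.B) (C := cc.C) ((⟨0, cc.A, 0, cc.B, cc.C⟩ : WeierstrassCurve ℚ)) rfl rfl rfl rfl rfl hirrF' haev h3 ρ hΔneg
        (w := fun i : Fin 0 => algebraMap (𝓞 K) K
          (((fun i : Fin 0 => i.elim0 : Fin 0 → (𝓞 K)ˣ) i : (𝓞 K)ˣ) : 𝓞 K))
        (g := fun j => algebraMap (𝓞 K) K (W j)) (fun i => i.elim0)
        (fun j => RingOfIntegers.coe_ne_zero_iff.mpr (hW0 j)) (fun i => i.elim0)
        (fun j => norm_of_famCheck hθ h3 hF) (fun i => i.elim0)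
        (fun j => sign_iff_of_famCheck hθ ρ hlo hhi hF (hfam j)) hc a ha T U hsq
    have h2 := valRow_sound_sel (A := cc.A) (B := cc.B) (C := cc.C) ((⟨0, cc.A, 0, cc.B, cc.C⟩ : WeierstrassCurve ℚ)) rfl rfl rfl rfl rfl haev
      (fc.W₁ hθ h3 hF hpr) (by rw [hderiv]; exact hDW₁) hW0
      (r := fun j => bitRow fc (fm.get j) 1) (fun j => by
        show ((!decide ((2 : ℤ) ∣ famL₁ (fm.get j))) = true ↔ _)
        rw [show algebraMap (𝓞 K) K (W j) = ((W j : 𝓞 K) : K) from rfl,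
          log_W₁_of_famCheck hθ h3 hF hpr (hfam j)]; simp) hc a ha T U hsq
    have h3' := valRow_sound_sel (A := cc.A) (B := cc.B) (C := cc.C) ((⟨0, cc.A, 0, cc.B, cc.C⟩ : WeierstrassCurve ℚ)) rfl rfl rfl rfl rfl haev
      (fc.W₂ hθ h3 hF hpr) (by rw [hderiv]; exact hDW₂) hW0
      (r := fun j => bitRow fc (fm.get j) 2) (fun j => by
        show ((!decide ((2 : ℤ) ∣ famL₂ (fm.get j))) = true ↔ _)
        rw [show algebraMap (𝓞 K) K (W j) = ((W j : 𝓞 K) : K) from rfl,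
          log_W₂_of_famCheck hθ h3 hF hpr (hfam j)]; simp) hc a ha T U hsq
    simp only [adm, Bool.and_eq_true]
    exact ⟨⟨admStdQ_of_admStd hQ h1, h2⟩, h3'⟩
  have hsel := natCard_selmerGroup_le_of_coverSet_cl (A := cc.A) (B := cc.B) (C := cc.C)
    ((⟨0, cc.A, 0, cc.B, cc.C⟩ : WeierstrassCurve ℚ)) rfl rfl rfl rfl rfl hirrF' haev h3 hM0 hgen hDM hW0 hspan
    (Wu := fun i : Fin 0 => i.elim0) (adm := adm fc cc) hadm
  exact sha_door_of_natCard_selmerGroup_two_lt ((⟨0, cc.A, 0, cc.B, cc.C⟩ : WeierstrassCurve ℚ)) (hsel.trans_lt hcount) hlow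

/-- **`K`-free wrapper: `t₂ = 0`, `Ш[2^∞] = 0`, `rank = r` from the two records** (model `(0, A, 0, B, C)` read
over `ℚ` from `ℤ`), in the exact shape of `rank_eq_of_certsLe`:
`sha_door_of_certsLe r <field> ⟨curve⟩ (by decide +kernel) (by norm_num [ClFieldCert.primeList]) (by decide +kernel) <lower bound>`.
[cite: Cassels1991LecturesEllipticCurves, §15] [cite: CremonaAlgorithms1997, §3.6] -/
theorem sha_door_of_certsLe (r : ℕ) (fc : ClFieldCert) (cc : ClCurveCert) (hF : fc.check = true)
    (hpr : fc.primeList.Forall Nat.Prime) (hc : checkLe r fc cc = true)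
    (hlow : r ≤ (((⟨0, cc.A, 0, cc.B, cc.C⟩ : WeierstrassCurve ℤ)).map (Int.castRingHom ℚ)).mordellWeilRank) :
    (((⟨0, cc.A, 0, cc.B, cc.C⟩ : WeierstrassCurve ℤ)).map (Int.castRingHom ℚ)).shaCorank 2 = 0 ∧
      AddCommGroup.primaryComponent (((⟨0, cc.A, 0, cc.B, cc.C⟩ : WeierstrassCurve ℤ)).map (Int.castRingHom ℚ)).sha 2
          = ⊥ ∧
        (((⟨0, cc.A, 0, cc.B, cc.C⟩ : WeierstrassCurve ℤ)).map (Int.castRingHom ℚ)).mordellWeilRank = r := by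
  have hE : ((⟨0, cc.A, 0, cc.B, cc.C⟩ : WeierstrassCurve ℤ)).map (Int.castRingHom ℚ) =
      (⟨0, cc.A, 0, cc.B, cc.C⟩ : WeierstrassCurve ℚ) := by
    ext <;> simp [WeierstrassCurve.map]
  rw [hE] at hlow ⊢
  haveI : Fact (Irreducible (MonicCubic.polyQ fc.a fc.b fc.c)) := ⟨fc.irreducible_of_check hF⟩
  exact sha_door_of_checkLe_cl (K := CubicField fc.a fc.b fc.c) r fc (CubicField.aeval_root fc.a fc.b fc.c)
    (CubicField.finrank_eq fc.a fc.b fc.c) hF hpr cc hc hlow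

/-- **`t₂(E) = 0` for the ORIGINAL model** `(a₁, a₂, a₃, a₄, a₆)` when the records certify its completed-square
model `(0, a₁² + 4a₂, 0, 8(a₁a₃ + 2a₄), 16(a₃² + 4a₆))` with the bound `r` and `r ≤ rank` (`t₂` and the rank are
invariant under the variable change), in the shape of `rank_eq_of_certsLe_complSq`.
[cite: CremonaAlgorithms1997, §3.6] [cite: SilvermanAEC2009, Thm. X.4.2] -/
theorem shaCorank_two_eq_zero_of_certsLe_complSq (r : ℕ) (fc : ClFieldCert) (cc : ClCurveCert)
    (hF : fc.check = true) (hpr : fc.primeList.Forall Nat.Prime) (hc : checkLe r fc cc = true)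
    (a₁ a₂ a₃ a₄ a₆ : ℤ)
    (hABC : cc.A = a₁ ^ 2 + 4 * a₂ ∧ cc.B = 8 * (a₁ * a₃ + 2 * a₄) ∧ cc.C = 16 * (a₃ ^ 2 + 4 * a₆))
    (hlow : r ≤ (((⟨a₁, a₂, a₃, a₄, a₆⟩ : WeierstrassCurve ℤ)).map (Int.castRingHom ℚ)).mordellWeilRank) :
    (((⟨a₁, a₂, a₃, a₄, a₆⟩ : WeierstrassCurve ℤ)).map (Int.castRingHom ℚ)).shaCorank 2 = 0 ∧
      (((⟨a₁, a₂, a₃, a₄, a₆⟩ : WeierstrassCurve ℤ)).map (Int.castRingHom ℚ)).mordellWeilRank = r := by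
  obtain ⟨hA, hB, hC⟩ := hABC
  have hV : (⟨Units.mk0 (1 / 2 : ℚ) (by norm_num), 0, -(a₁ : ℚ) / 2, -(a₃ : ℚ) / 2⟩ :
      WeierstrassCurve.VariableChange ℚ) • (((⟨a₁, a₂, a₃, a₄, a₆⟩ : WeierstrassCurve ℤ)).map (Int.castRingHom ℚ)) =
        ((⟨0, cc.A, 0, cc.B, cc.C⟩ : WeierstrassCurve ℤ)).map (Int.castRingHom ℚ) := by
    ext <;> simp only [WeierstrassCurve.map_a₁, WeierstrassCurve.map_a₂, WeierstrassCurve.map_a₃,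
      WeierstrassCurve.map_a₄, WeierstrassCurve.map_a₆, WeierstrassCurve.variableChange_a₁,
      WeierstrassCurve.variableChange_a₂, WeierstrassCurve.variableChange_a₃,
      WeierstrassCurve.variableChange_a₄, WeierstrassCurve.variableChange_a₆, Units.val_inv_eq_inv_val,
      Units.val_mk0, hA, hB, hC, eq_intCast, Int.cast_add, Int.cast_mul, Int.cast_pow, Int.cast_ofNat] <;> ring
  have hr : (((⟨a₁, a₂, a₃, a₄, a₆⟩ : WeierstrassCurve ℤ)).map (Int.castRingHom ℚ)).mordellWeilRank =
      (((⟨0, cc.A, 0, cc.B, cc.C⟩ : WeierstrassCurve ℤ)).map (Int.castRingHom ℚ)).mordellWeilRank :=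
    mordellWeilRank_eq_of_smul_eq _ _ _ hV
  rw [hr] at hlow ⊢
  obtain ⟨h0, -, hrank⟩ := sha_door_of_certsLe r fc cc hF hpr hc hlow
  refine ⟨?_, hrank⟩
  have hΔ : deltaShort cc.A cc.B cc.C ≠ 0 := by
    have hc' := hc
    simp only [checkLe, Bool.and_eq_true, decide_eq_true_eq] at hc'
    exact hc'.1.1.1.1.1.1.1.1.1.1.1.1.1.1
  have hE : ((⟨0, cc.A, 0, cc.B, cc.C⟩ : WeierstrassCurve ℤ)).map (Int.castRingHom ℚ) =
      (⟨0, cc.A, 0, cc.B, cc.C⟩ : WeierstrassCurve ℚ) := by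
    ext <;> simp [WeierstrassCurve.map]
  haveI h2 : (((⟨0, cc.A, 0, cc.B, cc.C⟩ : WeierstrassCurve ℤ)).map (Int.castRingHom ℚ)).IsElliptic := by
    rw [hE]; exact isElliptic_of_deltaShort_ne hΔ
  haveI h1 : (((⟨a₁, a₂, a₃, a₄, a₆⟩ : WeierstrassCurve ℤ)).map (Int.castRingHom ℚ)).IsElliptic := by
    rw [← inv_smul_smul (⟨Units.mk0 (1 / 2 : ℚ) (by norm_num), 0, -(a₁ : ℚ) / 2, -(a₃ : ℚ) / 2⟩ :
      WeierstrassCurve.VariableChange ℚ) (((⟨a₁, a₂, a₃, a₄, a₆⟩ : WeierstrassCurve ℤ)).map (Int.castRingHom ℚ)), hV]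
    infer_instance
  exact (shaCorank_eq_zero_iff_of_smul_eq _ _ _ hV 2).mpr h0

end Row

end Summit.BirchSwinnertonDyer.BirchSwinnertonDyer.Theorems.ShaPrimaryTransferSelmerCubicCover

end
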